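import Literature.Analysis.Hypoelliptic.KernelComposition
import Mathlib.Analysis.InnerProductSpace.Calculus
import Mathlib.Analysis.Calculus.MeanValue
import Mathlib.Analysis.SpecialFunctions.Pow.Deriv
import HarnessLib

/-!
# Multipliers on the Fourier side: first and second differences of radial symbols `ρ(1 + ‖ξ‖²)`, of `⟨ξ⟩^a` and of linear symbols

Analysis/Hypoelliptic support file, fifth piece of the Fourier-side toolkit serving the
discharge of `Literature.Analysis.Distribution.Hormander1967_thm11` by Kohn's method
(M. Taylor, *Pseudodifferential Operators* (1981), Ch. XV §1). It supplies the inputs of the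
commutator gains of `KernelOperators.lean` (`MulDiff`) and `KernelComposition.lean`
(`MulDiff2`):

* **Radial symbols.** For `φ(ξ) = ρ(1 + ‖ξ‖²)` with `|ρ'(t)| ≤ B₁ t^{(a-2)/2}` and
  `|ρ''(t)| ≤ B₂ t^{(a-4)/2}` on `t ≥ 1` (`ShapeBounds`), the first differences of `φ` are of
  order `a - 1` and the second differences of order `a - 2` (mean value theorem along the
  segments `η + τ(ξ - η)`, resp. twice along `η + τv + σu`, plus Peetre's inequality).
* **The Bessel symbols `⟨ξ⟩^a = bw a`** (`ρ(t) = t^{a/2}`): `MulBound` of order `a`,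
  `MulDiff` of order `a - 1`, `MulDiff2` of order `a - 2` — the classical symbol estimates
  behind `[⟨D⟩^a, a(x)] ∈ OPS^{a-1}` (Taylor 1981, Ch. II §4).
* **Linear symbols** `2πi⟪ξ, v⟫` (the Fourier side of `∂_v`): order `1`, differences of order
  `0`, vanishing second differences; and constants.

## References

* M. E. Taylor, *Pseudodifferential Operators* (1981), Ch. II §§1, 4; Ch. XV §1.
-/

noncomputable section

open MeasureTheory Set Filter Function
open scoped ENNReal NNReal Topology ComplexConjugate InnerProductSpace

namespace Literature.Analysis.Hypoelliptic

section NormOnly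

variable {V : Type*} [NormedAddCommGroup V] [NormedSpace ℝ V]

omit [NormedSpace ℝ V] in
/-- `⟨x⟩^s` is monotone in `‖x‖` for `s ≥ 0`. [folklore] -/
theorem bw_le_bw_of_norm_le {s : ℝ} (hs : 0 ≤ s) {x y : V} (h : ‖x‖ ≤ ‖y‖) :
    bw s x ≤ bw s y :=
  Real.rpow_le_rpow (one_add_norm_sq_pos x).le
    (by nlinarith [norm_nonneg x, norm_nonneg y]) (by linarith)

/-- `⟨τ • v⟩^s ≤ ⟨v⟩^s` for `|τ| ≤ 1`, `s ≥ 0`. [folklore] -/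
theorem bw_smul_le {s : ℝ} (hs : 0 ≤ s) {τ : ℝ} (hτ : |τ| ≤ 1) (v : V) :
    bw s (τ • v) ≤ bw s v :=
  bw_le_bw_of_norm_le hs (by
    rw [norm_smul, Real.norm_eq_abs]
    exact mul_le_of_le_one_left (norm_nonneg v) hτ)

omit [NormedSpace ℝ V] in
/-- `(1 + ‖x‖²)^{s/2} = bw s x`. [folklore] -/
theorem rpow_one_add_norm_sq (s : ℝ) (x : V) : (1 + ‖x‖ ^ 2) ^ (s / 2) = bw s x := rfl

omit [NormedSpace ℝ V] in
/-- `‖x‖ ⟨x⟩^{s} ≤ ⟨x⟩^{s+1}`. [folklore] -/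
theorem norm_mul_bw_le (s : ℝ) (x : V) : ‖x‖ * bw s x ≤ bw (s + 1) x := by
  rw [bw_add, mul_comm]
  exact mul_le_mul_of_nonneg_left (norm_le_bw_one x) (bw_nonneg _ _)

omit [NormedSpace ℝ V] in
/-- For `τ ∈ [0, 1)`: `|τ| ≤ 1`. [folklore] -/
theorem abs_le_one_of_mem_Ico {τ : ℝ} (hτ : τ ∈ Ico (0 : ℝ) 1) : |τ| ≤ 1 := by
  rw [abs_of_nonneg hτ.1]; exact hτ.2.le

/-- The radial multiplier `φ(ξ) = ρ(1 + ‖ξ‖²)`, complex-valued. [folklore] -/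
def radial (ρ : ℝ → ℝ) (ξ : V) : ℂ :=
  (ρ (1 + ‖ξ‖ ^ 2) : ℂ)

omit [NormedSpace ℝ V] in
/-- Unfolding `radial`. [folklore] -/
@[simp] theorem radial_apply (ρ : ℝ → ℝ) (ξ : V) : radial ρ ξ = (ρ (1 + ‖ξ‖ ^ 2) : ℂ) := rfl

end NormOnly

section Calculus

variable {V : Type*} [NormedAddCommGroup V] [InnerProductSpace ℝ V]

/-! ### Calculus along segments -/

/-- The segment `τ ↦ x₀ + τ • v` has derivative `v`. [folklore] -/
theorem hasDerivAt_line (x₀ v : V) (τ : ℝ) : HasDerivAt (fun τ : ℝ => x₀ + τ • v) v τ := by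
  have h := ((hasDerivAt_id τ).smul_const v).const_add x₀
  simpa using h

/-- `τ ↦ 1 + ‖c τ‖²` has derivative `2⟪c τ, v⟫` when `c` has derivative `v`. [folklore] -/
theorem hasDerivAt_one_add_norm_sq {c : ℝ → V} {v : V} {τ : ℝ} (hc : HasDerivAt c v τ) :
    HasDerivAt (fun τ => 1 + ‖c τ‖ ^ 2) (2 * ⟪c τ, v⟫_ℝ) τ :=
  hc.norm_sq.const_add 1

/-- `τ ↦ ⟪c τ, u⟫` has derivative `⟪v, u⟫` when `c` has derivative `v`. [folklore] -/
theorem hasDerivAt_inner_const {c : ℝ → V} {v : V} {τ : ℝ} (hc : HasDerivAt c v τ) (u : V) :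
    HasDerivAt (fun τ => ⟪c τ, u⟫_ℝ) ⟪v, u⟫_ℝ τ := by
  have h := hc.inner ℝ (hasDerivAt_const τ u)
  simpa using h

/-! ### Shape bounds for radial symbols -/

/-- **Shape bounds of order `a`** for a profile `ρ` on `t ≥ 1`: derivatives `ρ'`, `ρ''` with
`|ρ'(t)| ≤ B₁ t^{(a-2)/2}` and `|ρ''(t)| ≤ B₂ t^{(a-4)/2}` (the symbol estimates of
`ρ(1 + ‖ξ‖²) ∈ S^a` up to second order). [folklore] -/
structure ShapeBounds (ρ ρ' ρ'' : ℝ → ℝ) (a B₁ B₂ : ℝ) : Prop where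
  hasDeriv : ∀ t, 1 ≤ t → HasDerivAt ρ (ρ' t) t
  hasDeriv2 : ∀ t, 1 ≤ t → HasDerivAt ρ' (ρ'' t) t
  nonneg₁ : 0 ≤ B₁
  nonneg₂ : 0 ≤ B₂
  bound₁ : ∀ t, 1 ≤ t → |ρ' t| ≤ B₁ * t ^ ((a - 2) / 2)
  bound₂ : ∀ t, 1 ≤ t → |ρ'' t| ≤ B₂ * t ^ ((a - 4) / 2)

namespace ShapeBounds

variable {ρ ρ' ρ'' : ℝ → ℝ} {a B₁ B₂ : ℝ}

/-- The bound on the derivative along a segment: `|ρ'(1+‖x‖²) · 2⟪x, v⟫| ≤ 2B₁ ⟨x⟩^{a-1} ‖v‖`.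
[folklore] -/
theorem abs_deriv_line_le (h : ShapeBounds ρ ρ' ρ'' a B₁ B₂) (x v : V) :
    |ρ' (1 + ‖x‖ ^ 2) * (2 * ⟪x, v⟫_ℝ)| ≤ 2 * B₁ * bw (a - 1) x * ‖v‖ := by
  have h1 := h.bound₁ (1 + ‖x‖ ^ 2) (one_le_one_add_norm_sq x)
  rw [rpow_one_add_norm_sq] at h1
  have h2 : |⟪x, v⟫_ℝ| ≤ bw 1 x * ‖v‖ :=
    (abs_real_inner_le_norm x v).trans (mul_le_mul_of_nonneg_right (norm_le_bw_one x)
      (norm_nonneg v))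
  rw [abs_mul, abs_mul, abs_two]
  calc |ρ' (1 + ‖x‖ ^ 2)| * (2 * |⟪x, v⟫_ℝ|) ≤ (B₁ * bw (a - 2) x) * (2 * (bw 1 x * ‖v‖)) :=
        mul_le_mul h1 (mul_le_mul_of_nonneg_left h2 zero_le_two) (by positivity)
          (mul_nonneg h.nonneg₁ (bw_nonneg _ _))
    _ = 2 * B₁ * (bw (a - 2) x * bw 1 x) * ‖v‖ := by ring
    _ = 2 * B₁ * bw (a - 1) x * ‖v‖ := by rw [← bw_add, show a - 2 + 1 = a - 1 by ring]

/-- The bound on the mixed second derivative: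
`|ρ''·(2⟪x,v⟫)(2⟪x,u⟫) + ρ'·(2⟪v,u⟫)| ≤ (4B₂ + 2B₁) ⟨x⟩^{a-2} ‖u‖ ‖v‖`. [folklore] -/
theorem abs_deriv2_line_le (h : ShapeBounds ρ ρ' ρ'' a B₁ B₂) (x u v : V) :
    |ρ'' (1 + ‖x‖ ^ 2) * (2 * ⟪x, v⟫_ℝ) * (2 * ⟪x, u⟫_ℝ) + ρ' (1 + ‖x‖ ^ 2) * (2 * ⟪v, u⟫_ℝ)| ≤
      (4 * B₂ + 2 * B₁) * bw (a - 2) x * ‖u‖ * ‖v‖ := by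
  have h1 := h.bound₁ (1 + ‖x‖ ^ 2) (one_le_one_add_norm_sq x)
  have h2 := h.bound₂ (1 + ‖x‖ ^ 2) (one_le_one_add_norm_sq x)
  rw [rpow_one_add_norm_sq] at h1 h2
  have hxv := abs_real_inner_le_norm x v
  have hxu := abs_real_inner_le_norm x u
  have hvu := abs_real_inner_le_norm v u
  have hx2 : ‖x‖ ^ 2 * bw (a - 4) x ≤ bw (a - 2) x := by
    have : ‖x‖ ^ 2 ≤ bw 2 x := by rw [bw_two]; linarith
    calc ‖x‖ ^ 2 * bw (a - 4) x ≤ bw 2 x * bw (a - 4) x :=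
          mul_le_mul_of_nonneg_right this (bw_nonneg _ _)
      _ = bw (a - 2) x := by rw [← bw_add, show (2 : ℝ) + (a - 4) = a - 2 by ring]
  have hB₁ := h.nonneg₁
  have hB₂ := h.nonneg₂
  calc |ρ'' (1 + ‖x‖ ^ 2) * (2 * ⟪x, v⟫_ℝ) * (2 * ⟪x, u⟫_ℝ) + ρ' (1 + ‖x‖ ^ 2) * (2 * ⟪v, u⟫_ℝ)|
      ≤ |ρ'' (1 + ‖x‖ ^ 2) * (2 * ⟪x, v⟫_ℝ) * (2 * ⟪x, u⟫_ℝ)| +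
          |ρ' (1 + ‖x‖ ^ 2) * (2 * ⟪v, u⟫_ℝ)| := abs_add_le _ _
    _ = |ρ'' (1 + ‖x‖ ^ 2)| * (2 * |⟪x, v⟫_ℝ|) * (2 * |⟪x, u⟫_ℝ|) +
          |ρ' (1 + ‖x‖ ^ 2)| * (2 * |⟪v, u⟫_ℝ|) := by
        simp only [abs_mul, abs_two]
    _ ≤ (B₂ * bw (a - 4) x) * (2 * (‖x‖ * ‖v‖)) * (2 * (‖x‖ * ‖u‖)) +
          (B₁ * bw (a - 2) x) * (2 * (‖v‖ * ‖u‖)) := by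
        refine add_le_add ?_ ?_
        · exact mul_le_mul (mul_le_mul h2 (mul_le_mul_of_nonneg_left hxv zero_le_two)
            (by positivity) (mul_nonneg hB₂ (bw_nonneg _ _)))
            (mul_le_mul_of_nonneg_left hxu zero_le_two) (by positivity)
            (mul_nonneg (mul_nonneg hB₂ (bw_nonneg _ _)) (by positivity))
        · exact mul_le_mul h1 (mul_le_mul_of_nonneg_left hvu zero_le_two) (by positivity)
            (mul_nonneg hB₁ (bw_nonneg _ _))
    _ = 4 * B₂ * (‖x‖ ^ 2 * bw (a - 4) x) * ‖u‖ * ‖v‖ + 2 * B₁ * bw (a - 2) x * ‖u‖ * ‖v‖ := by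
        ring
    _ ≤ 4 * B₂ * bw (a - 2) x * ‖u‖ * ‖v‖ + 2 * B₁ * bw (a - 2) x * ‖u‖ * ‖v‖ := by
        refine add_le_add ?_ le_rfl
        exact mul_le_mul_of_nonneg_right (mul_le_mul_of_nonneg_right
          (mul_le_mul_of_nonneg_left hx2 (by positivity)) (norm_nonneg _)) (norm_nonneg _)
    _ = (4 * B₂ + 2 * B₁) * bw (a - 2) x * ‖u‖ * ‖v‖ := by ring

/-- **First differences of a radial symbol of order `a` are of order `a - 1`**:
`|ρ(1+‖ξ‖²) - ρ(1+‖η‖²)| ≤ 2B₁ 2^{|a-1|/2} ⟨ξ - η⟩^{|a-1|+1} ⟨η⟩^{a-1}` (mean value theorem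
along `η + τ(ξ - η)`, Peetre). [folklore] -/
theorem abs_sub_le (h : ShapeBounds ρ ρ' ρ'' a B₁ B₂) (ξ η : V) :
    |ρ (1 + ‖ξ‖ ^ 2) - ρ (1 + ‖η‖ ^ 2)| ≤
      2 * B₁ * 2 ^ (|a - 1| / 2) * bw (|a - 1| + 1) (ξ - η) * bw (a - 1) η := by
  set v : V := ξ - η with hv
  set f : ℝ → ℝ := fun τ => ρ (1 + ‖η + τ • v‖ ^ 2) with hf
  set f' : ℝ → ℝ := fun τ => ρ' (1 + ‖η + τ • v‖ ^ 2) * (2 * ⟪η + τ • v, v⟫_ℝ) with hf'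
  set C : ℝ := 2 * B₁ * (2 ^ (|a - 1| / 2) * bw (a - 1) η * bw |a - 1| v) * ‖v‖ with hC
  have hderiv : ∀ τ ∈ Icc (0 : ℝ) 1, HasDerivWithinAt f (f' τ) (Icc (0 : ℝ) 1) τ := by
    intro τ _
    have hp := hasDerivAt_one_add_norm_sq (hasDerivAt_line η v τ)
    have hρ := h.hasDeriv (1 + ‖η + τ • v‖ ^ 2) (one_le_one_add_norm_sq _)
    exact (hρ.comp τ hp).hasDerivWithinAt
  have hbound : ∀ τ ∈ Ico (0 : ℝ) 1, ‖f' τ‖ ≤ C := by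
    intro τ hτ
    rw [Real.norm_eq_abs, hf']
    refine (h.abs_deriv_line_le (η + τ • v) v).trans ?_
    have hP := peetre (a - 1) η (τ • v)
    have hs := bw_smul_le (abs_nonneg (a - 1)) (abs_le_one_of_mem_Ico hτ) v
    rw [hC]
    refine mul_le_mul_of_nonneg_right (mul_le_mul_of_nonneg_left (hP.trans ?_)
      (mul_nonneg zero_le_two h.nonneg₁)) (norm_nonneg v)
    exact mul_le_mul_of_nonneg_left hs (mul_nonneg (by positivity) (bw_nonneg _ _))
  have hMVT := norm_image_sub_le_of_norm_deriv_le_segment_01' hderiv hbound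
  simp only [hf, one_smul, zero_smul, add_zero, Real.norm_eq_abs] at hMVT
  rw [show η + v = ξ by rw [hv]; abel] at hMVT
  refine hMVT.trans ?_
  calc C = 2 * B₁ * 2 ^ (|a - 1| / 2) * (‖v‖ * bw |a - 1| v) * bw (a - 1) η := by rw [hC]; ring
    _ ≤ 2 * B₁ * 2 ^ (|a - 1| / 2) * bw (|a - 1| + 1) v * bw (a - 1) η :=
        mul_le_mul_of_nonneg_right (mul_le_mul_of_nonneg_left (norm_mul_bw_le |a - 1| v)
          (mul_nonneg (mul_nonneg zero_le_two h.nonneg₁) (by positivity))) (bw_nonneg _ _)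

/-- **Second differences of a radial symbol of order `a` are of order `a - 2`**:
`|φ(η+u+v) - φ(η+u) - φ(η+v) + φ(η)| ≤ (4B₂+2B₁) 2^{|a-2|} ⟨u⟩^{|a-2|+1} ⟨v⟩^{|a-2|+1} ⟨η⟩^{a-2}`
(`φ = ρ(1+‖·‖²)`; mean value theorem twice, Peetre twice). [folklore] -/
theorem abs_sub_sub_add_le (h : ShapeBounds ρ ρ' ρ'' a B₁ B₂) (η u v : V) :
    |ρ (1 + ‖η + u + v‖ ^ 2) - ρ (1 + ‖η + u‖ ^ 2) - ρ (1 + ‖η + v‖ ^ 2) + ρ (1 + ‖η‖ ^ 2)| ≤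
      (4 * B₂ + 2 * B₁) * 2 ^ |a - 2| * bw (|a - 2| + 1) u * bw (|a - 2| + 1) v *
        bw (a - 2) η := by
  -- the bound of the mixed second derivative on the unit square
  set B : ℝ := (4 * B₂ + 2 * B₁) * (2 ^ (|a - 2| / 2) * bw (a - 2) η *
    (2 ^ (|a - 2| / 2) * bw |a - 2| u * bw |a - 2| v)) * ‖u‖ * ‖v‖ with hB
  have hBnn : 0 ≤ 4 * B₂ + 2 * B₁ :=
    add_nonneg (mul_nonneg (by norm_num) h.nonneg₂) (mul_nonneg zero_le_two h.nonneg₁)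
  -- `m σ τ = ∂_σ ρ(1 + ‖η + τ v + σ u‖²)`
  set m : ℝ → ℝ → ℝ := fun σ τ =>
    ρ' (1 + ‖η + τ • v + σ • u‖ ^ 2) * (2 * ⟪η + τ • v + σ • u, u⟫_ℝ) with hm
  -- Step 1: for each `σ ∈ [0,1)`, `|m σ 1 - m σ 0| ≤ B` (MVT in `τ`)
  have hstep1 : ∀ σ ∈ Ico (0 : ℝ) 1, |m σ 1 - m σ 0| ≤ B := by
    intro σ hσ
    set g : ℝ → ℝ := fun τ => m σ τ with hg
    set g' : ℝ → ℝ := fun τ =>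
      ρ'' (1 + ‖η + τ • v + σ • u‖ ^ 2) * (2 * ⟪η + τ • v + σ • u, v⟫_ℝ) *
          (2 * ⟪η + τ • v + σ • u, u⟫_ℝ) +
        ρ' (1 + ‖η + τ • v + σ • u‖ ^ 2) * (2 * ⟪v, u⟫_ℝ) with hg'
    have hcurve : ∀ τ : ℝ, HasDerivAt (fun τ : ℝ => η + τ • v + σ • u) v τ := fun τ =>
      (hasDerivAt_line η v τ).add_const (σ • u)
    have hderiv : ∀ τ ∈ Icc (0 : ℝ) 1, HasDerivWithinAt g (g' τ) (Icc (0 : ℝ) 1) τ := by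
      intro τ _
      have hp := hasDerivAt_one_add_norm_sq (hcurve τ)
      have hρ' := h.hasDeriv2 (1 + ‖η + τ • v + σ • u‖ ^ 2) (one_le_one_add_norm_sq _)
      have h1 : HasDerivAt (fun τ => ρ' (1 + ‖η + τ • v + σ • u‖ ^ 2))
          (ρ'' (1 + ‖η + τ • v + σ • u‖ ^ 2) * (2 * ⟪η + τ • v + σ • u, v⟫_ℝ)) τ :=
        hρ'.comp τ hp
      have h2 : HasDerivAt (fun τ => 2 * ⟪η + τ • v + σ • u, u⟫_ℝ) (2 * ⟪v, u⟫_ℝ) τ :=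
        (hasDerivAt_inner_const (hcurve τ) u).const_mul 2
      have h3 := h1.mul h2
      simp only [hg, hm]
      exact h3.hasDerivWithinAt
    have hbound : ∀ τ ∈ Ico (0 : ℝ) 1, ‖g' τ‖ ≤ B := by
      intro τ hτ
      rw [Real.norm_eq_abs, hg']
      refine (h.abs_deriv2_line_le (η + τ • v + σ • u) u v).trans ?_
      -- Peetre: `bw (a-2) (η + (τ v + σ u)) ≤ 2^{|a-2|/2} bw (a-2) η bw |a-2| (τ v + σ u)`
      have hP := peetre (a - 2) η (τ • v + σ • u)
      rw [← add_assoc] at hP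
      have hP2 := peetre_of_nonneg (abs_nonneg (a - 2)) (σ • u) (τ • v)
      rw [add_comm (σ • u)] at hP2
      have hsu := bw_smul_le (abs_nonneg (a - 2)) (abs_le_one_of_mem_Ico hσ) u
      have hsv := bw_smul_le (abs_nonneg (a - 2)) (abs_le_one_of_mem_Ico hτ) v
      have hw : bw |a - 2| (τ • v + σ • u) ≤ 2 ^ (|a - 2| / 2) * bw |a - 2| u * bw |a - 2| v :=
        hP2.trans (mul_le_mul (mul_le_mul_of_nonneg_left hsu (by positivity)) hsv
          (bw_nonneg _ _) (mul_nonneg (by positivity) (bw_nonneg _ _)))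
      have hx : bw (a - 2) (η + τ • v + σ • u) ≤ 2 ^ (|a - 2| / 2) * bw (a - 2) η *
          (2 ^ (|a - 2| / 2) * bw |a - 2| u * bw |a - 2| v) :=
        hP.trans (mul_le_mul_of_nonneg_left hw (mul_nonneg (by positivity) (bw_nonneg _ _)))
      rw [hB]
      exact mul_le_mul_of_nonneg_right (mul_le_mul_of_nonneg_right
        (mul_le_mul_of_nonneg_left hx hBnn) (norm_nonneg _)) (norm_nonneg _)
    have hMVT := norm_image_sub_le_of_norm_deriv_le_segment_01' hderiv hbound
    rwa [Real.norm_eq_abs] at hMVT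
  -- Step 2: `k σ = ρ(1 + ‖η + v + σu‖²) - ρ(1 + ‖η + σu‖²)` has derivative `m σ 1 - m σ 0`
  set k : ℝ → ℝ := fun σ => ρ (1 + ‖η + (1 : ℝ) • v + σ • u‖ ^ 2) -
    ρ (1 + ‖η + (0 : ℝ) • v + σ • u‖ ^ 2) with hk
  have hkderiv : ∀ σ ∈ Icc (0 : ℝ) 1,
      HasDerivWithinAt k (m σ 1 - m σ 0) (Icc (0 : ℝ) 1) σ := by
    intro σ _
    have hd : ∀ τ : ℝ, HasDerivAt (fun σ => ρ (1 + ‖η + τ • v + σ • u‖ ^ 2)) (m σ τ) σ := by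
      intro τ
      have hp := hasDerivAt_one_add_norm_sq (hasDerivAt_line (η + τ • v) u σ)
      have hρ := h.hasDeriv (1 + ‖η + τ • v + σ • u‖ ^ 2) (one_le_one_add_norm_sq _)
      exact hρ.comp σ hp
    exact ((hd 1).sub (hd 0)).hasDerivWithinAt
  have hkbound : ∀ σ ∈ Ico (0 : ℝ) 1, ‖m σ 1 - m σ 0‖ ≤ B := fun σ hσ => by
    rw [Real.norm_eq_abs]; exact hstep1 σ hσ
  have hMVT := norm_image_sub_le_of_norm_deriv_le_segment_01' hkderiv hkbound
  simp only [hk, one_smul, zero_smul, add_zero, Real.norm_eq_abs] at hMVT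
  have e1 : η + v + u = η + u + v := by abel
  rw [e1] at hMVT
  have e2 : ρ (1 + ‖η + u + v‖ ^ 2) - ρ (1 + ‖η + u‖ ^ 2) - (ρ (1 + ‖η + v‖ ^ 2) -
      ρ (1 + ‖η‖ ^ 2)) = ρ (1 + ‖η + u + v‖ ^ 2) - ρ (1 + ‖η + u‖ ^ 2) -
        ρ (1 + ‖η + v‖ ^ 2) + ρ (1 + ‖η‖ ^ 2) := by ring
  rw [e2] at hMVT
  refine hMVT.trans ?_
  have h2pow : (2 : ℝ) ^ (|a - 2| / 2) * 2 ^ (|a - 2| / 2) = 2 ^ |a - 2| := by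
    rw [← Real.rpow_add two_pos]; ring_nf
  calc B = (4 * B₂ + 2 * B₁) * (2 ^ (|a - 2| / 2) * 2 ^ (|a - 2| / 2)) *
        (‖u‖ * bw |a - 2| u) * (‖v‖ * bw |a - 2| v) * bw (a - 2) η := by rw [hB]; ring
    _ ≤ (4 * B₂ + 2 * B₁) * 2 ^ |a - 2| * bw (|a - 2| + 1) u * bw (|a - 2| + 1) v *
        bw (a - 2) η := by
        rw [h2pow]
        refine mul_le_mul_of_nonneg_right ?_ (bw_nonneg _ _)
        exact mul_le_mul (mul_le_mul_of_nonneg_left (norm_mul_bw_le _ u)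
          (mul_nonneg hBnn (by positivity))) (norm_mul_bw_le _ v)
          (mul_nonneg (norm_nonneg _) (bw_nonneg _ _))
          (mul_nonneg (mul_nonneg hBnn (by positivity)) (bw_nonneg _ _))

end ShapeBounds

end Calculus

/-! ### The certificates -/

section Certificates

variable {V : Type*} [NormedAddCommGroup V] [InnerProductSpace ℝ V] [MeasurableSpace V]
  [BorelSpace V]

/-- **`MulDiff` for radial symbols**: first differences of `ρ(1 + ‖ξ‖²)` are of order `a - 1`
with constants `2B₁2^{|a-1|/2}` and `M = |a - 1| + 1`. [folklore] -/
theorem ShapeBounds.mulDiff_radial {ρ ρ' ρ'' : ℝ → ℝ} {a B₁ B₂ : ℝ}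
    (h : ShapeBounds ρ ρ' ρ'' a B₁ B₂) (hρm : Measurable ρ) :
    MulDiff (radial (V := V) ρ) (a - 1) (2 * B₁ * 2 ^ (|a - 1| / 2)) (|a - 1| + 1) where
  measurable := Complex.measurable_ofReal.comp (hρm.comp (by fun_prop))
  nonneg := mul_nonneg (mul_nonneg zero_le_two h.nonneg₁) (by positivity)
  bound ξ η := by
    rw [radial_apply, radial_apply, ← Complex.ofReal_sub, Complex.norm_real, Real.norm_eq_abs]
    exact h.abs_sub_le ξ η

/-- **`MulDiff2` for radial symbols**: second differences of `ρ(1 + ‖ξ‖²)` are of order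
`a - 2` with constants `(4B₂ + 2B₁)2^{|a-2|}` and `M = |a - 2| + 1`. [folklore] -/
theorem ShapeBounds.mulDiff2_radial {ρ ρ' ρ'' : ℝ → ℝ} {a B₁ B₂ : ℝ}
    (h : ShapeBounds ρ ρ' ρ'' a B₁ B₂) (hρm : Measurable ρ) :
    MulDiff2 (radial (V := V) ρ) (a - 2) ((4 * B₂ + 2 * B₁) * 2 ^ |a - 2|) (|a - 2| + 1) where
  measurable := Complex.measurable_ofReal.comp (hρm.comp (by fun_prop))
  nonneg := mul_nonneg (add_nonneg (mul_nonneg (by norm_num) h.nonneg₂)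
    (mul_nonneg zero_le_two h.nonneg₁)) (by positivity)
  bound η u v := by
    simp only [radial_apply, ← Complex.ofReal_sub, ← Complex.ofReal_add, Complex.norm_real,
      Real.norm_eq_abs]
    exact h.abs_sub_sub_add_le η u v

/-! ### The Bessel symbols `⟨ξ⟩^a` -/

/-- The profile `t ↦ t^{a/2}` of the Bessel symbol `⟨ξ⟩^a` satisfies the shape bounds of order
`a` with `B₁ = |a|/2`, `B₂ = |a/2| |a/2 - 1|`. [folklore] -/
theorem shapeBounds_rpow (a : ℝ) :
    ShapeBounds (fun t => t ^ (a / 2)) (fun t => a / 2 * t ^ (a / 2 - 1))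
      (fun t => a / 2 * ((a / 2 - 1) * t ^ (a / 2 - 2))) a (|a| / 2) (|a / 2| * |a / 2 - 1|) where
  hasDeriv t ht := by
    have h := Real.hasDerivAt_rpow_const (p := a / 2) (Or.inl (by linarith : t ≠ 0))
    simpa [mul_comm] using h
  hasDeriv2 t ht := by
    have h := (Real.hasDerivAt_rpow_const (p := a / 2 - 1) (Or.inl (by linarith : t ≠ 0))).const_mul
      (a / 2)
    refine h.congr_deriv ?_
    rw [show a / 2 - 1 - 1 = a / 2 - 2 by ring]
  nonneg₁ := by positivity
  nonneg₂ := by positivity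
  bound₁ t ht := by
    rw [abs_mul, abs_of_nonneg (Real.rpow_nonneg (by linarith) _), abs_div, abs_two,
      show a / 2 - 1 = (a - 2) / 2 by ring]
  bound₂ t ht := by
    rw [abs_mul, abs_mul, abs_of_nonneg (Real.rpow_nonneg (by linarith) _),
      show a / 2 - 2 = (a - 4) / 2 by ring, mul_assoc]

omit [InnerProductSpace ℝ V] [MeasurableSpace V] [BorelSpace V] in
/-- The Bessel symbol is the radial multiplier of the profile `t^{a/2}`. [folklore] -/
theorem radial_rpow (a : ℝ) : radial (V := V) (fun t => t ^ (a / 2)) = fun ξ => (bw a ξ : ℂ) :=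
  rfl

/-- **First differences of `⟨ξ⟩^a` are of order `a - 1`** (constants `|a| 2^{|a-1|/2}`,
`M = |a - 1| + 1`): the symbol estimate behind `[⟨D⟩^a, a(x)] ∈ OPS^{a-1}`. [folklore] -/
theorem mulDiff_bw (a : ℝ) :
    MulDiff (fun ξ : V => (bw a ξ : ℂ)) (a - 1) (2 * (|a| / 2) * 2 ^ (|a - 1| / 2))
      (|a - 1| + 1) := by
  have h := (shapeBounds_rpow a).mulDiff_radial (V := V) (measurable_id.pow_const (a / 2))
  rwa [radial_rpow] at h

/-- **Second differences of `⟨ξ⟩^a` are of order `a - 2`** (`M = |a - 2| + 1`): the symbol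
estimate behind `[b, [⟨D⟩^a, a]] ∈ OPS^{a-2}`. [folklore] -/
theorem mulDiff2_bw (a : ℝ) :
    MulDiff2 (fun ξ : V => (bw a ξ : ℂ)) (a - 2)
      ((4 * (|a / 2| * |a / 2 - 1|) + 2 * (|a| / 2)) * 2 ^ |a - 2|) (|a - 2| + 1) := by
  have h := (shapeBounds_rpow a).mulDiff2_radial (V := V) (measurable_id.pow_const (a / 2))
  rwa [radial_rpow] at h

/-! ### Linear symbols and constants -/

/-- The linear symbol `2πi⟪ξ, v⟫` of the directional derivative `∂_v`
(`𝓕(∂_v u)(ξ) = 2πi⟪ξ, v⟫ 𝓕u(ξ)` with Mathlib's Fourier conventions). [folklore] -/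
def linMul (v : V) (ξ : V) : ℂ :=
  2 * Real.pi * Complex.I * (⟪ξ, v⟫_ℝ : ℂ)

omit [MeasurableSpace V] [BorelSpace V] in
/-- Unfolding `linMul`. [folklore] -/
@[simp] theorem linMul_apply (v ξ : V) :
    linMul v ξ = 2 * Real.pi * Complex.I * (⟪ξ, v⟫_ℝ : ℂ) := rfl

omit [MeasurableSpace V] [BorelSpace V] in
/-- `‖2πi⟪ξ, v⟫‖ = 2π |⟪ξ, v⟫|`. [folklore] -/
theorem norm_linMul (v ξ : V) : ‖linMul v ξ‖ = 2 * Real.pi * |⟪ξ, v⟫_ℝ| := by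
  rw [linMul_apply, norm_mul, norm_mul, norm_mul, Complex.norm_I, Complex.norm_real,
    Complex.norm_real, Complex.norm_two, Real.norm_eq_abs, Real.norm_eq_abs,
    abs_of_pos Real.pi_pos, mul_one]

/-- `linMul` is measurable. [folklore] -/
theorem measurable_linMul (v : V) : Measurable (linMul v) := by
  unfold linMul
  exact measurable_const.mul (Complex.measurable_ofReal.comp
    ((continuous_id.inner continuous_const).measurable))

/-- **The linear symbol is a multiplier of order `1`** (constant `2π‖v‖`). [folklore] -/
theorem mulBound_linMul (v : V) : MulBound (linMul v) 1 (2 * Real.pi * ‖v‖) where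
  measurable := measurable_linMul v
  nonneg := by positivity
  bound ξ := by
    rw [norm_linMul]
    calc 2 * Real.pi * |⟪ξ, v⟫_ℝ| ≤ 2 * Real.pi * (‖ξ‖ * ‖v‖) :=
          mul_le_mul_of_nonneg_left (abs_real_inner_le_norm ξ v) (by positivity)
      _ ≤ 2 * Real.pi * (bw 1 ξ * ‖v‖) :=
          mul_le_mul_of_nonneg_left (mul_le_mul_of_nonneg_right (norm_le_bw_one ξ)
            (norm_nonneg v)) (by positivity)
      _ = 2 * Real.pi * ‖v‖ * bw 1 ξ := by ring

/-- **First differences of the linear symbol are of order `0`**: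
`‖2πi⟪ξ,v⟫ - 2πi⟪η,v⟫‖ ≤ 2π‖v‖ ⟨ξ - η⟩ ⟨η⟩⁰`. [folklore] -/
theorem mulDiff_linMul (v : V) : MulDiff (linMul v) 0 (2 * Real.pi * ‖v‖) 1 where
  measurable := measurable_linMul v
  nonneg := by positivity
  bound ξ η := by
    have h1 : linMul v ξ - linMul v η = linMul v (ξ - η) := by
      simp only [linMul_apply, inner_sub_left, Complex.ofReal_sub]; ring
    rw [h1, norm_linMul, bw_zero, mul_one]
    calc 2 * Real.pi * |⟪ξ - η, v⟫_ℝ| ≤ 2 * Real.pi * (‖ξ - η‖ * ‖v‖) :=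
          mul_le_mul_of_nonneg_left (abs_real_inner_le_norm _ v) (by positivity)
      _ ≤ 2 * Real.pi * (bw 1 (ξ - η) * ‖v‖) :=
          mul_le_mul_of_nonneg_left (mul_le_mul_of_nonneg_right (norm_le_bw_one _)
            (norm_nonneg v)) (by positivity)
      _ = 2 * Real.pi * ‖v‖ * bw 1 (ξ - η) := by ring

/-- **Second differences of the linear symbol vanish** (any order, constant `0`). [folklore] -/
theorem mulDiff2_linMul (v : V) (m M : ℝ) : MulDiff2 (linMul v) m 0 M where
  measurable := measurable_linMul v
  nonneg := le_rfl
  bound η u w := by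
    have h0 : linMul v (η + u + w) - linMul v (η + u) - linMul v (η + w) + linMul v η = 0 := by
      simp only [linMul_apply, inner_add_left, Complex.ofReal_add]; ring
    rw [h0, norm_zero]
    simp

end Certificates

section NormCerts

variable {V : Type*} [NormedAddCommGroup V] [MeasurableSpace V]

/-- **`⟨ξ⟩^a` is a multiplier of order `a`** (constant `1`). [folklore] -/
theorem mulBound_bw [OpensMeasurableSpace V] (a : ℝ) : MulBound (fun ξ : V => (bw a ξ : ℂ)) a 1 where
  measurable := Complex.measurable_ofReal.comp (measurable_bw a)
  nonneg := zero_le_one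
  bound ξ := by rw [Complex.norm_real, Real.norm_of_nonneg (bw_nonneg _ _), one_mul]

/-- **Constants are multipliers of order `0`.** [folklore] -/
theorem mulBound_const (c : ℂ) : MulBound (fun _ : V => c) 0 ‖c‖ where
  measurable := measurable_const
  nonneg := norm_nonneg c
  bound ξ := by rw [bw_zero, mul_one]

/-- Differences of constants vanish. [folklore] -/
theorem mulDiff_const (c : ℂ) (m M : ℝ) : MulDiff (fun _ : V => c) m 0 M where
  measurable := measurable_const
  nonneg := le_rfl
  bound ξ η := by simp

/-- Second differences of constants vanish. [folklore] -/
theorem mulDiff2_const (c : ℂ) (m M : ℝ) : MulDiff2 (fun _ : V => c) m 0 M where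
  measurable := measurable_const
  nonneg := le_rfl
  bound η u v := by simp

/-- Sums of multipliers of the same order. [folklore] -/
theorem MulBound.add {φ ψ : V → ℂ} {m c c' : ℝ} (hφ : MulBound φ m c) (hψ : MulBound ψ m c') :
    MulBound (fun ξ => φ ξ + ψ ξ) m (c + c') where
  measurable := hφ.measurable.add hψ.measurable
  nonneg := add_nonneg hφ.nonneg hψ.nonneg
  bound ξ := (norm_add_le _ _).trans (by rw [add_mul]; exact add_le_add (hφ.bound ξ) (hψ.bound ξ))

/-- Scalar multiples of multipliers. [folklore] -/
theorem MulBound.const_mul {φ : V → ℂ} {m c : ℝ} (hφ : MulBound φ m c) (z : ℂ) :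
    MulBound (fun ξ => z * φ ξ) m (‖z‖ * c) where
  measurable := measurable_const.mul hφ.measurable
  nonneg := mul_nonneg (norm_nonneg z) hφ.nonneg
  bound ξ := by
    rw [norm_mul, mul_assoc]
    exact mul_le_mul_of_nonneg_left (hφ.bound ξ) (norm_nonneg z)

/-- Raising the order of a multiplier. [folklore] -/
theorem MulBound.mono {φ : V → ℂ} {m m' c : ℝ} (hφ : MulBound φ m c) (hm : m ≤ m') :
    MulBound φ m' c where
  measurable := hφ.measurable
  nonneg := hφ.nonneg
  bound ξ := (hφ.bound ξ).trans (mul_le_mul_of_nonneg_left (bw_mono hm ξ) hφ.nonneg)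

/-- Products of multipliers: orders add. [folklore] -/
theorem MulBound.mul {φ ψ : V → ℂ} {m m' c c' : ℝ} (hφ : MulBound φ m c)
    (hψ : MulBound ψ m' c') : MulBound (fun ξ => φ ξ * ψ ξ) (m + m') (c * c') where
  measurable := hφ.measurable.mul hψ.measurable
  nonneg := mul_nonneg hφ.nonneg hψ.nonneg
  bound ξ := by
    rw [norm_mul, bw_add]
    calc ‖φ ξ‖ * ‖ψ ξ‖ ≤ (c * bw m ξ) * (c' * bw m' ξ) :=
          mul_le_mul (hφ.bound ξ) (hψ.bound ξ) (norm_nonneg _) (mul_nonneg hφ.nonneg (bw_nonneg _ _))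
      _ = c * c' * (bw m ξ * bw m' ξ) := by ring

/-- Sums of `MulDiff` certificates (same order and `M`). [folklore] -/
theorem MulDiff.add {φ ψ : V → ℂ} {m d d' M : ℝ} (hφ : MulDiff φ m d M) (hψ : MulDiff ψ m d' M) :
    MulDiff (fun ξ => φ ξ + ψ ξ) m (d + d') M where
  measurable := hφ.measurable.add hψ.measurable
  nonneg := add_nonneg hφ.nonneg hψ.nonneg
  bound ξ η := by
    calc ‖φ ξ + ψ ξ - (φ η + ψ η)‖ = ‖(φ ξ - φ η) + (ψ ξ - ψ η)‖ := by congr 1; ring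
      _ ≤ ‖φ ξ - φ η‖ + ‖ψ ξ - ψ η‖ := norm_add_le _ _
      _ ≤ _ := by rw [add_mul, add_mul]; exact add_le_add (hφ.bound ξ η) (hψ.bound ξ η)

/-- Scalar multiples of `MulDiff` certificates. [folklore] -/
theorem MulDiff.const_mul {φ : V → ℂ} {m d M : ℝ} (hφ : MulDiff φ m d M) (z : ℂ) :
    MulDiff (fun ξ => z * φ ξ) m (‖z‖ * d) M where
  measurable := measurable_const.mul hφ.measurable
  nonneg := mul_nonneg (norm_nonneg z) hφ.nonneg
  bound ξ η := by
    rw [← mul_sub, norm_mul, mul_assoc, mul_assoc]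
    exact mul_le_mul_of_nonneg_left (by rw [← mul_assoc]; exact hφ.bound ξ η) (norm_nonneg z)

end NormCerts

end Literature.Analysis.Hypoelliptic
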